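import Literature.Computability.AlgebraicComplexity.NewtonPolygonTauProductPlusOneTools
import HarnessLib

/-!
# KPTT 2015, Appendix: the Newton polygon of `fg + 1` (Proposition 2, Theorem 7)

P. Koiran, N. Portier, S. Tavenas, S. Thomassé, *A τ-conjecture for Newton polygons*, Found.
Comput. Math. 15 (2015) 185–197 (arXiv:1308.2286), Appendix "the Newton polygon of `fg+1`" (held
text p0011) and §5 Final Remarks (p0008:L9–L19: "Consider two polynomials `f, g` with at most `t`
monomials each. What is the maximum number of edges on the Newton polygon of `fg+1`? … Theorem 5
provides a `O(t^{4/3})` upper bound, but as far as we know the 'true' bound could be linear in `t`.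
In the appendix we prove a linear upper bound under the assumption that `f` and `g` have the same
supports and that …"). This is KPTT's only printed positive result on the `fg + 1` /
`f_1 ⋯ f_m + 1` problem of §5, the "next case" named by the V5 routes of this summit
(`Theses/NewtonFrames.lean`, `Theses/NewtonUnitEquations.lean` quote "KPTT App. Thm 7").

Printed hypotheses (p0011:L7–L13). "(i) The polynomials `f` and `g` have the same support, i.e.,
`Mon(f) = Mon(g)`. We denote by `{p_0, …, p_{t-1}}` this common support. (ii) If `f` and `g` have a
constant term we assume without loss of generality that `p_0 = 0` and we add the following
requirement: if `p_j` is an extremal point of `conv(p_1, p_2, …, p_{t-1})` then `2p_j` is not in the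
support of `f` and `g`."

Printed statements.
* **Proposition 2** (p0011:L29–L33; the case "`f` and `g` have a constant term but `fg + 1` has no
  constant term", `p_0 = 0`): "Under assumptions (i) and (ii),
  `Newt(fg+1) = conv(2p_1, …, 2p_{t-1}, (p_i)_{i ∈ I})` where `(p_i)_{i ∈ I}` is the subset of those
  monomials in `Mon(f)` which appear in `fg+1` with a nonzero coefficient."
* **Lemma 3** (p0011:L97–L99): "If `p`, `q`, `r` are 3 distinct nonzero points in the plane then the
  6 points `p, q, r, 2p, 2q, 2r` are not convexly independent."
* **Theorem 7** (p0011:L70–L72): "Under the same assumptions (i) and (ii) as above, `Newt(fg+1)` has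
  at most `t + 1` edges where `t` denotes the number of monomials of `f` and `g`."

Rendering (all theorems, 0 definitions, 0 named facts; second of two files — the geometric tools,
Lemma 3 in vertex form `KPTT.ProductPlusOne.not_six_extremePoints` and the equal-support vertex
lemma `KPTT.extremePoints_newton_mul_subset_of_support_eq`, are in
`NewtonPolygonTauProductPlusOneTools.lean`). Polynomials over a commutative domain `k` (the appendix
is characteristic-free: a product of two nonzero coefficients is nonzero); supports embedded in
`ℝ²` by `e ↦ (e₀, e₁)` exactly as in the tree's `newtonVertexCount`; hypotheses (i), (ii) are
inlined binders with the printed wording; "`2p_j`" is `2 • p_j`; "`(p_i)_{i∈I}`" is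
`Mon(f) ∖ {0} ∩ Mon(fg+1)`. EDGES VS VERTICES: KPTT count edges, the tree's `newtonVertexCount`
counts vertices (extreme points of `Newt`); a polygon with `v ≥ 3` vertices has `v` edges, a
segment has 2 vertices and 1 edge, a point 1 vertex and 0 edges — so the vertex bound `≤ t + 1`
proved here is the printed edge bound in the polygon case and implies it in the degenerate cases.
* `KPTT.newtonVertexCount_mul_add_one_le_of_coeff_ne` — Theorem 7 when `fg + 1` has a constant
  term (printed cases 1–2; (ii) not needed): vertices `⊆ {0} ∪ vert Newt(fg)`.
* `KPTT.add_self_mem_support_mul_add_one` — the doubled extremal monomials `2p_j`, `j ∈ J`, are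
  monomials of `fg + 1` (the heart of Proposition 2, where (ii) is used).
* `KPTT.convexHull_support_mul_add_one_eq` — **Proposition 2**.
* `KPTT.newtonVertexCount_mul_add_one_le_of_coeff_eq` — Theorem 7 when `fg + 1` has no constant
  term (printed case 3: Proposition 2 + Lemma 3, `|J| + |K| ≤ (t - 1) + 2`).
* `KPTT.newtonVertexCount_mul_add_one_le` — **Theorem 7**: `#vert Newt(fg + 1) ≤ t + 1`.

Honest framing (val-lit): a kernel proof of KPTT's only printed positive result toward the
`fg + 1` / `f_1 ⋯ f_m + 1` question of §5, which itself stays OPEN (crux `ProductMinusPoints` of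
route NewtonFrames; KPTT: "We do not know how to prove a linear upper bound assuming only (i)");
nothing here bears on `VP ≠ VNP`, which is NOT proved.

## References

* P. Koiran, N. Portier, S. Tavenas, S. Thomassé, Found. Comput. Math. 15 (2015) 185–197,
  arXiv:1308.2286: Appendix (Proposition 2, Theorem 7, Lemma 3), §5 Final Remarks
  [KoiranPortierTavenasThomasse2015].
-/

noncomputable section

open Finset MvPolynomial
open scoped Pointwise

namespace Literature.Computability.AlgebraicComplexity

namespace KPTT

/-! ### Polynomials: `Newt(fg + 1)` -/

section Polys

open ProductPlusOne PlanarMinkowski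

variable {k : Type*} [CommRing k] [IsDomain k]

/-- The real embedding of exponent vectors is additive. [folklore] -/
private theorem natEmb_add' (e e' : Fin 2 →₀ ℕ) :
    (fun i : Fin 2 => (((e + e') i : ℕ) : ℝ)) =
      (fun i : Fin 2 => ((e i : ℕ) : ℝ)) + fun i : Fin 2 => ((e' i : ℕ) : ℝ) := by
  ext i; simp

/-- The real embedding of exponent vectors is injective. [folklore] -/
private theorem natEmb_injective' :
    Function.Injective fun e : Fin 2 →₀ ℕ => fun i : Fin 2 => ((e i : ℕ) : ℝ) := by
  intro e e' h
  ext i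
  have hi := congr_fun h i
  simp only [Nat.cast_inj] at hi
  exact hi

/-- Doubling under the embedding: `emb (p + p) = 2 • emb p`. [folklore] -/
private theorem natEmb_add_self (p : Fin 2 →₀ ℕ) :
    (fun i : Fin 2 => (((p + p) i : ℕ) : ℝ)) = (2 : ℝ) • fun i : Fin 2 => ((p i : ℕ) : ℝ) := by
  ext i; simp [two_mul]

/-- A nonzero exponent vector embeds to a nonzero point. [folklore] -/
private theorem natEmb_ne_zero {p : Fin 2 →₀ ℕ} (hp : p ≠ 0) :
    (fun i : Fin 2 => ((p i : ℕ) : ℝ)) ≠ 0 := by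
  intro h; apply hp; ext i
  have hi := congr_fun h i
  simp only [Pi.zero_apply, Nat.cast_eq_zero] at hi
  exact hi

/-- `p + p = q + q → p = q` in `ℕ²`. [folklore] -/
private theorem add_self_injective {p q : Fin 2 →₀ ℕ} (h : p + p = q + q) : p = q := by
  ext i
  have hi := DFunLike.congr_fun h i
  simp only [Finsupp.coe_add, Pi.add_apply] at hi
  omega

/-- `p + p ≠ 0` for `p ≠ 0`. [folklore] -/
private theorem add_self_ne_zero {p : Fin 2 →₀ ℕ} (hp : p ≠ 0) : p + p ≠ 0 := by
  intro h; apply hp; ext i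
  have hi := DFunLike.congr_fun h i
  simp only [Finsupp.coe_add, Pi.add_apply, Finsupp.coe_zero, Pi.zero_apply] at hi
  simp only [Finsupp.coe_zero, Pi.zero_apply]
  omega

/-! ### The support of `fg + 1` -/

omit [IsDomain k] in
/-- Coefficients of `h + 1`. [folklore] -/
private theorem coeff_add_one' (h : MvPolynomial (Fin 2) k) (e : Fin 2 →₀ ℕ) :
    coeff e (h + 1) = coeff e h + if e = 0 then 1 else 0 := by
  classical
  rw [coeff_add, coeff_one]
  by_cases he : e = 0
  · simp [he]
  · simp [he, Ne.symm he]

omit [IsDomain k] in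
/-- If `fg + 1` has a constant term, `Mon(fg + 1) = Mon(fg) ∪ {0}`. [folklore] -/
private theorem support_add_one_of_coeff_ne {h : MvPolynomial (Fin 2) k} (h0 : (h + 1).coeff 0 ≠ 0) :
    (h + 1).support = insert 0 h.support := by
  classical
  ext e
  rw [Finset.mem_insert, mem_support_iff, mem_support_iff]
  by_cases he : e = 0
  · subst he; simp only [true_or, iff_true]; exact h0
  · rw [coeff_add_one', if_neg he, add_zero]; simp [he]

omit [IsDomain k] in
/-- If `fg + 1` has no constant term, `Mon(fg + 1) = Mon(fg) ∖ {0}`. [folklore] -/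
private theorem support_add_one_of_coeff_eq {h : MvPolynomial (Fin 2) k} (h0 : (h + 1).coeff 0 = 0) :
    (h + 1).support = h.support.erase 0 := by
  classical
  ext e
  rw [Finset.mem_erase, mem_support_iff, mem_support_iff]
  by_cases he : e = 0
  · subst he; simp only [ne_eq, not_true_eq_false, false_and, iff_false, not_not]; exact h0
  · rw [coeff_add_one', if_neg he, add_zero]; simp [he]

/-! ### Theorem 7, the case where `fg + 1` has a constant term -/

/-- **Theorem 7 when `fg + 1` has a constant term** (the first two cases of the printed proof:
"If `0` does not belong to this support then `Newt(fg+1)` is the convex hull of `{0}` and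
`Newt(fg)` … If `0` is in the support and `fg+1` has a constant term then `Newt(fg+1) = Newt(fg)`
has at most `t` edges"): the vertices of `Newt(fg + 1)` are among `0` and the (at most `t`) vertices
of `Newt(fg)`, so there are at most `t + 1` of them; hypothesis (ii) is not needed here.
[cite: KoiranPortierTavenasThomasse2015, Appendix, proof of Thm. 7 (held text p0011:L74–L84)] -/
theorem newtonVertexCount_mul_add_one_le_of_coeff_ne (f g : MvPolynomial (Fin 2) k)
    (hfg : f.support = g.support) (h0 : (f * g + 1).coeff 0 ≠ 0) :
    newtonVertexCount (f * g + 1) ≤ f.support.card + 1 := by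
  classical
  set emb : (Fin 2 →₀ ℕ) → (Fin 2 → ℝ) := fun e i => ((e i : ℕ) : ℝ) with hemb
  have hsupp : ((f * g + 1).support : Set (Fin 2 →₀ ℕ)) = insert 0 ((f * g).support : Set (Fin 2 →₀ ℕ)) := by
    rw [support_add_one_of_coeff_ne h0, Finset.coe_insert]
  set P' : Set (Fin 2 → ℝ) := convexHull ℝ (emb '' ((f * g).support : Set (Fin 2 →₀ ℕ))) with hP'
  have hsub : (convexHull ℝ (emb '' ((f * g + 1).support : Set (Fin 2 →₀ ℕ)))).extremePoints ℝ ⊆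
      insert (emb 0) (P'.extremePoints ℝ) := by
    intro v hv
    rw [hsupp, Set.image_insert_eq] at hv
    have hvmem := extremePoints_convexHull_subset hv
    rcases Set.mem_insert_iff.1 hvmem with h | h
    · exact Set.mem_insert_iff.2 (Or.inl h)
    · refine Set.mem_insert_of_mem _ (inter_extremePoints_subset_extremePoints_of_subset
        (convexHull_mono (Set.subset_insert _ _)) ⟨subset_convexHull ℝ _ h, hv⟩)
  have hfin : (insert (emb 0) (P'.extremePoints ℝ)).Finite :=
    (((f * g).support.finite_toSet.image emb).subset extremePoints_convexHull_subset).insert _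
  have hmul := newtonVertexCount_mul_le_card_of_support_eq f g hfg
  unfold newtonVertexCount at hmul ⊢
  calc (Set.extremePoints ℝ (convexHull ℝ (emb '' ((f * g + 1).support : Set (Fin 2 →₀ ℕ))))).ncard
      ≤ (insert (emb 0) (P'.extremePoints ℝ)).ncard := Set.ncard_le_ncard hsub hfin
    _ ≤ (P'.extremePoints ℝ).ncard + 1 := Set.ncard_insert_le _ _
    _ ≤ f.support.card + 1 := by rw [hP']; exact Nat.add_le_add_right hmul 1

/-! ### Proposition 2 and Theorem 7 when `fg + 1` has no constant term -/

/-- If `fg + 1` has no constant term then `f` has one (`f_0 g_0 = -1`). [folklore] -/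
private theorem zero_mem_support_of_coeff_eq {f g : MvPolynomial (Fin 2) k}
    (h0 : (f * g + 1).coeff 0 = 0) : (0 : Fin 2 →₀ ℕ) ∈ f.support := by
  rw [mem_support_iff]
  intro hf0
  rw [coeff_add_one', if_pos rfl] at h0
  have hc : coeff 0 (f * g) = constantCoeff f * constantCoeff g := by
    rw [← constantCoeff_eq]; exact map_mul constantCoeff f g
  rw [hc, constantCoeff_eq, hf0, zero_mul, zero_add] at h0
  exact one_ne_zero h0

/-- **The doubled extremal monomials survive** (proof of Proposition 2, "Any monomial of the form
`2p_j` with `j ∈ J` appears in `fg+1` with a nonzero coefficient because it can be obtained in a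
unique way by expansion of the product `fg` … If `i ≥ 1` and `k ≥ 1`, this is impossible by
construction of `J`. If `i = 0` or `k = 0`, this is also impossible by hypothesis (ii)"): under (i)
and (ii), if `p ≠ 0` is a monomial of `f` whose embedding is a vertex of `conv(Mon(f) ∖ {0})`, then
`2p ∈ Mon(fg + 1)`. [cite: KoiranPortierTavenasThomasse2015, Appendix, proof of Prop. 2 (held text p0011:L47–L58)] -/
theorem add_self_mem_support_mul_add_one (f g : MvPolynomial (Fin 2) k) (hfg : f.support = g.support)
    (hii : ∀ p ∈ f.support, p ≠ 0 →
      (fun i : Fin 2 => ((p i : ℕ) : ℝ)) ∈ (convexHull ℝ ((fun e : Fin 2 →₀ ℕ => fun i : Fin 2 => ((e i : ℕ) : ℝ)) ''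
        ((f.support.erase 0 : Finset (Fin 2 →₀ ℕ)) : Set (Fin 2 →₀ ℕ)))).extremePoints ℝ →
      2 • p ∉ f.support)
    {p : Fin 2 →₀ ℕ} (hp : p ∈ f.support) (hp0 : p ≠ 0)
    (hpx : (fun i : Fin 2 => ((p i : ℕ) : ℝ)) ∈ (convexHull ℝ ((fun e : Fin 2 →₀ ℕ => fun i : Fin 2 => ((e i : ℕ) : ℝ)) ''
        ((f.support.erase 0 : Finset (Fin 2 →₀ ℕ)) : Set (Fin 2 →₀ ℕ)))).extremePoints ℝ) :
    p + p ∈ (f * g + 1).support := by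
  classical
  set emb : (Fin 2 →₀ ℕ) → (Fin 2 → ℝ) := fun e i => ((e i : ℕ) : ℝ) with hemb
  have h2p : 2 • p ∉ f.support := hii p hp hp0 hpx
  rw [two_nsmul] at h2p
  -- the coefficient of `2p` in `fg` is `f_p g_p`
  have hcoeff : coeff (p + p) (f * g) = coeff p f * coeff p g := by
    rw [coeff_mul, Finset.sum_eq_single (p, p)]
    · rintro ⟨α, β⟩ hmem hne
      rw [Finset.HasAntidiagonal.mem_antidiagonal] at hmem
      dsimp only at hmem
      by_contra hprod
      have hα : coeff α f ≠ 0 := fun h => hprod (by rw [h, zero_mul])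
      have hβ : coeff β g ≠ 0 := fun h => hprod (by rw [h, mul_zero])
      have hαS : α ∈ f.support := mem_support_iff.2 hα
      have hβS : β ∈ f.support := by rw [hfg]; exact mem_support_iff.2 hβ
      by_cases hα0 : α = 0
      · rw [hα0, zero_add] at hmem; rw [hmem] at hβS; exact h2p hβS
      by_cases hβ0 : β = 0
      · rw [hβ0, add_zero] at hmem; rw [hmem] at hαS; exact h2p hαS
      have hαβ : α ≠ β := by
        intro h; subst h
        exact hne (Prod.ext (add_self_injective hmem) (add_self_injective hmem))
      -- `emb p` is the midpoint of the distinct points `emb α`, `emb β` of `Mon(f) ∖ {0}`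
      have hαm : emb α ∈ emb '' ((f.support.erase 0 : Finset (Fin 2 →₀ ℕ)) : Set (Fin 2 →₀ ℕ)) :=
        ⟨α, Finset.mem_coe.2 (Finset.mem_erase.2 ⟨hα0, hαS⟩), rfl⟩
      have hβm : emb β ∈ emb '' ((f.support.erase 0 : Finset (Fin 2 →₀ ℕ)) : Set (Fin 2 →₀ ℕ)) :=
        ⟨β, Finset.mem_coe.2 (Finset.mem_erase.2 ⟨hβ0, hβS⟩), rfl⟩
      have hseg : emb p ∈ openSegment ℝ (emb α) (emb β) := by
        rw [mem_openSegment_iff_div]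
        refine ⟨1, 1, one_pos, one_pos, ?_⟩
        have hsum : emb α + emb β = (2 : ℝ) • emb p := by
          rw [show emb α + emb β = emb (α + β) from (natEmb_add' α β).symm, hmem]
          exact natEmb_add_self p
        rw [← smul_add, hsum, smul_smul]
        norm_num
      have hext := (mem_extremePoints.1 hpx).2 _ (subset_convexHull ℝ _ hαm) _ (subset_convexHull ℝ _ hβm) hseg
      exact hαβ (natEmb_injective' (hext.1.trans hext.2.symm))
    · intro h
      exact absurd (by simp) h
  have hpg : p ∈ g.support := by rw [← hfg]; exact hp
  rw [mem_support_iff, coeff_add_one', if_neg (add_self_ne_zero hp0), add_zero, hcoeff]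
  exact mul_ne_zero (mem_support_iff.1 hp) (mem_support_iff.1 hpg)

/-- **KPTT 2015, Appendix, Proposition 2.** Printed: "Under assumptions (i) and (ii),
`Newt(fg+1) = conv(2p_1, …, 2p_{t-1}, (p_i)_{i ∈ I})` where `(p_i)_{i ∈ I}` is the subset of those
monomials in `Mon(f)` which appear in `fg+1` with a nonzero coefficient" — in the case considered
there: `f`, `g` have a constant term (`p_0 = 0`) but `fg + 1` has none (the hypothesis
`(f * g + 1).coeff 0 = 0`, which forces `0 ∈ Mon(f)`). Here `conv` of the embedded support of
`fg + 1` equals `conv` of the doubled points `2p`, `p ∈ Mon(f) ∖ {0}`, together with the points of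
`Mon(f) ∖ {0}` that are monomials of `fg + 1`. Proof as printed (left to right: a monomial
`p_i + p_j` of `fg + 1` is one of the `p_i` or the midpoint of `2p_i`, `2p_j`; right to left: the
doubled EXTREMAL points `2p_j` are monomials of `fg + 1`, `add_self_mem_support_mul_add_one`, and
they carry the hull of all the `2p_j`). [cite: KoiranPortierTavenasThomasse2015, Appendix, Prop. 2 (held text p0011:L29–L59)] -/
theorem convexHull_support_mul_add_one_eq (f g : MvPolynomial (Fin 2) k) (hfg : f.support = g.support)
    (h0 : (f * g + 1).coeff 0 = 0)
    (hii : ∀ p ∈ f.support, p ≠ 0 →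
      (fun i : Fin 2 => ((p i : ℕ) : ℝ)) ∈ (convexHull ℝ ((fun e : Fin 2 →₀ ℕ => fun i : Fin 2 => ((e i : ℕ) : ℝ)) ''
        ((f.support.erase 0 : Finset (Fin 2 →₀ ℕ)) : Set (Fin 2 →₀ ℕ)))).extremePoints ℝ →
      2 • p ∉ f.support) :
    convexHull ℝ ((fun e : Fin 2 →₀ ℕ => fun i : Fin 2 => ((e i : ℕ) : ℝ)) ''
        ((f * g + 1).support : Set (Fin 2 →₀ ℕ))) =
      convexHull ℝ ((fun e : Fin 2 →₀ ℕ => fun i : Fin 2 => (((e + e) i : ℕ) : ℝ)) ''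
          ((f.support.erase 0 : Finset (Fin 2 →₀ ℕ)) : Set (Fin 2 →₀ ℕ)) ∪
        (fun e : Fin 2 →₀ ℕ => fun i : Fin 2 => ((e i : ℕ) : ℝ)) ''
          ((f.support.erase 0 ∩ (f * g + 1).support : Finset (Fin 2 →₀ ℕ)) : Set (Fin 2 →₀ ℕ))) := by
  classical
  set emb : (Fin 2 →₀ ℕ) → (Fin 2 → ℝ) := fun e i => ((e i : ℕ) : ℝ) with hemb
  have hdbl : (fun e : Fin 2 →₀ ℕ => fun i : Fin 2 => (((e + e) i : ℕ) : ℝ)) = fun e => emb (e + e) := rfl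
  rw [hdbl]
  set S' : Finset (Fin 2 →₀ ℕ) := f.support.erase 0 with hS'
  set T : Finset (Fin 2 →₀ ℕ) := (f * g + 1).support with hT
  set P : Set (Fin 2 → ℝ) := convexHull ℝ (emb '' (T : Set (Fin 2 →₀ ℕ))) with hP
  have hTeq : T = (f * g).support.erase 0 := support_add_one_of_coeff_eq h0
  apply Set.Subset.antisymm
  · -- left to right: every monomial of `fg + 1` lies in the right-hand hull
    refine convexHull_min ?_ (convex_convexHull ℝ _)
    rintro _ ⟨e, he, rfl⟩
    have heT : e ∈ T := Finset.mem_coe.1 he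
    have he' : e ∈ (f * g).support.erase 0 := hTeq ▸ heT
    obtain ⟨he0, hefg⟩ := Finset.mem_erase.1 he'
    obtain ⟨α, hα, β, hβ, rfl⟩ := Finset.mem_add.1 (MvPolynomial.support_mul f g hefg)
    rw [← hfg] at hβ
    by_cases hα0 : α = 0
    · subst hα0
      rw [zero_add] at he0 heT ⊢
      exact subset_convexHull ℝ _ (Set.mem_union_right _
        ⟨β, Finset.mem_coe.2 (Finset.mem_inter.2 ⟨Finset.mem_erase.2 ⟨he0, hβ⟩, heT⟩), rfl⟩)
    by_cases hβ0 : β = 0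
    · subst hβ0
      rw [add_zero] at he0 heT ⊢
      exact subset_convexHull ℝ _ (Set.mem_union_right _
        ⟨α, Finset.mem_coe.2 (Finset.mem_inter.2 ⟨Finset.mem_erase.2 ⟨he0, hα⟩, heT⟩), rfl⟩)
    -- `emb (α + β)` is the midpoint of `emb (2α)` and `emb (2β)`
    have hαm : emb (α + α) ∈ (fun e => emb (e + e)) '' (S' : Set (Fin 2 →₀ ℕ)) ∪
        emb '' ((S' ∩ T : Finset (Fin 2 →₀ ℕ)) : Set (Fin 2 →₀ ℕ)) :=
      Set.mem_union_left _ ⟨α, Finset.mem_coe.2 (Finset.mem_erase.2 ⟨hα0, hα⟩), rfl⟩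
    have hβm : emb (β + β) ∈ (fun e => emb (e + e)) '' (S' : Set (Fin 2 →₀ ℕ)) ∪
        emb '' ((S' ∩ T : Finset (Fin 2 →₀ ℕ)) : Set (Fin 2 →₀ ℕ)) :=
      Set.mem_union_left _ ⟨β, Finset.mem_coe.2 (Finset.mem_erase.2 ⟨hβ0, hβ⟩), rfl⟩
    refine segment_subset_convexHull hαm hβm ⟨1 / 2, 1 / 2, by norm_num, by norm_num, by norm_num, ?_⟩
    ext i
    simp only [hemb, Pi.add_apply, Pi.smul_apply, Finsupp.coe_add, smul_eq_mul, Nat.cast_add]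
    ring
  · -- right to left: the generators lie in `Newt(fg + 1)`
    refine convexHull_min ?_ (convex_convexHull ℝ _)
    rintro v (⟨p, hp, rfl⟩ | ⟨p, hp, rfl⟩)
    · -- a doubled point `2p`, `p ∈ Mon(f) ∖ {0}`: `p ∈ conv(ext conv S')`, double by linearity
      have hpS' : p ∈ S' := Finset.mem_coe.1 hp
      set X : Set (Fin 2 → ℝ) := (convexHull ℝ (emb '' (S' : Set (Fin 2 →₀ ℕ)))).extremePoints ℝ with hX
      have hpX : emb p ∈ convexHull ℝ X := by
        rw [hX, Literature.Analysis.Convex.convexHull_extremePoints_convexHull (𝕜 := ℝ)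
          ((S'.finite_toSet).image emb)]
        exact subset_convexHull ℝ _ ⟨p, hp, rfl⟩
      let L : (Fin 2 → ℝ) →ₗ[ℝ] (Fin 2 → ℝ) := (2 : ℝ) • LinearMap.id
      have hLX : L '' X ⊆ P := by
        rintro _ ⟨x, hx, rfl⟩
        obtain ⟨q, hq, rfl⟩ := extremePoints_convexHull_subset hx
        obtain ⟨hq0, hqS⟩ := Finset.mem_erase.1 (Finset.mem_coe.1 hq)
        have hmem := add_self_mem_support_mul_add_one f g hfg hii hqS hq0 hx
        refine subset_convexHull ℝ _ ⟨q + q, Finset.mem_coe.2 hmem, ?_⟩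
        simp only [L, LinearMap.smul_apply, LinearMap.id_apply]
        exact natEmb_add_self q
      have h2p : emb (p + p) = L (emb p) := by
        simp only [L, LinearMap.smul_apply, LinearMap.id_apply]; exact natEmb_add_self p
      show emb (p + p) ∈ P
      rw [h2p]
      have : L (emb p) ∈ L '' convexHull ℝ X := Set.mem_image_of_mem _ hpX
      rw [LinearMap.image_convexHull] at this
      exact convexHull_min hLX (convex_convexHull ℝ _) this
    · -- a point of `Mon(f) ∖ {0}` that is a monomial of `fg + 1`
      exact subset_convexHull ℝ _ ⟨p, Finset.mem_coe.2 (Finset.mem_inter.1 (Finset.mem_coe.1 hp)).2, rfl⟩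

/-- **Theorem 7 when `fg + 1` has no constant term** (the third case of the printed proof: by
Proposition 2 the vertices are among the `2p_j` and the `p_k`, `j ∈ J`, `k ∈ K ⊆ {1, …, t-1}`; by
Lemma 3, `|J ∩ K| ≤ 2`, so there are at most `|J ∪ K| + |J ∩ K| ≤ (t - 1) + 2` vertices).
[cite: KoiranPortierTavenasThomasse2015, Appendix, proof of Thm. 7 (held text p0011:L85–L95)] -/
theorem newtonVertexCount_mul_add_one_le_of_coeff_eq (f g : MvPolynomial (Fin 2) k)
    (hfg : f.support = g.support) (h0 : (f * g + 1).coeff 0 = 0)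
    (hii : ∀ p ∈ f.support, p ≠ 0 →
      (fun i : Fin 2 => ((p i : ℕ) : ℝ)) ∈ (convexHull ℝ ((fun e : Fin 2 →₀ ℕ => fun i : Fin 2 => ((e i : ℕ) : ℝ)) ''
        ((f.support.erase 0 : Finset (Fin 2 →₀ ℕ)) : Set (Fin 2 →₀ ℕ)))).extremePoints ℝ →
      2 • p ∉ f.support) :
    newtonVertexCount (f * g + 1) ≤ f.support.card + 1 := by
  classical
  set emb : (Fin 2 →₀ ℕ) → (Fin 2 → ℝ) := fun e i => ((e i : ℕ) : ℝ) with hemb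
  have hS0 : (0 : Fin 2 →₀ ℕ) ∈ f.support := zero_mem_support_of_coeff_eq h0
  set S' : Finset (Fin 2 →₀ ℕ) := f.support.erase 0 with hS'
  set T : Finset (Fin 2 →₀ ℕ) := (f * g + 1).support with hT
  set P : Set (Fin 2 → ℝ) := convexHull ℝ (emb '' (T : Set (Fin 2 →₀ ℕ))) with hP
  set V : Set (Fin 2 → ℝ) := P.extremePoints ℝ with hV
  have hProp2 := convexHull_support_mul_add_one_eq f g hfg h0 hii
  -- the vertices are among the generators of Proposition 2
  have hVW : V ⊆ (fun e => emb (e + e)) '' (S' : Set (Fin 2 →₀ ℕ)) ∪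
      emb '' ((S' ∩ T : Finset (Fin 2 →₀ ℕ)) : Set (Fin 2 →₀ ℕ)) := by
    rw [hV, hP, show emb = fun e : Fin 2 →₀ ℕ => fun i : Fin 2 => ((e i : ℕ) : ℝ) from rfl, hT, hProp2]
    exact extremePoints_convexHull_subset
  set J : Finset (Fin 2 →₀ ℕ) := S'.filter fun p => emb (p + p) ∈ V with hJ
  set K : Finset (Fin 2 →₀ ℕ) := S'.filter fun p => emb p ∈ V with hK
  have hVJK : V ⊆ ((J.image fun p => emb (p + p)) ∪ K.image emb : Finset (Fin 2 → ℝ)) := by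
    intro v hv
    rw [Finset.coe_union, Finset.coe_image, Finset.coe_image]
    rcases hVW hv with ⟨p, hp, rfl⟩ | ⟨p, hp, rfl⟩
    · exact Set.mem_union_left _ ⟨p, Finset.mem_coe.2 (Finset.mem_filter.2 ⟨Finset.mem_coe.1 hp, hv⟩), rfl⟩
    · exact Set.mem_union_right _ ⟨p, Finset.mem_coe.2
        (Finset.mem_filter.2 ⟨(Finset.mem_inter.1 (Finset.mem_coe.1 hp)).1, hv⟩), rfl⟩
  -- Lemma 3: at most two `p` have both `p` and `2p` among the vertices
  have hJK : (J ∩ K).card ≤ 2 := by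
    by_contra hlt
    obtain ⟨p, hp, q, hq, r, hr, hpq, hpr, hqr⟩ := Finset.two_lt_card.1 (not_le.1 hlt)
    have hmem : ∀ {s}, s ∈ J ∩ K → s ≠ 0 ∧ emb s ∈ V ∧ (2 : ℝ) • emb s ∈ V := by
      intro s hs
      obtain ⟨hsJ, hsK⟩ := Finset.mem_inter.1 hs
      refine ⟨(Finset.mem_erase.1 (Finset.mem_filter.1 hsK).1).1, (Finset.mem_filter.1 hsK).2, ?_⟩
      rw [← natEmb_add_self s]; exact (Finset.mem_filter.1 hsJ).2
    obtain ⟨hp0, hp1, hp2⟩ := hmem hp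
    obtain ⟨hq0, hq1, hq2⟩ := hmem hq
    obtain ⟨hr0, hr1, hr2⟩ := hmem hr
    exact not_six_extremePoints (convex_convexHull ℝ _) (natEmb_ne_zero hp0) (natEmb_ne_zero hr0)
      (fun h => hpq (natEmb_injective' h)) (fun h => hpr (natEmb_injective' h))
      (fun h => hqr (natEmb_injective' h)) hp1 hq1 hr1 hp2 hq2 hr2
  have hJKS : J ∪ K ⊆ S' := Finset.union_subset (Finset.filter_subset _ _) (Finset.filter_subset _ _)
  have hcardS' : S'.card = f.support.card - 1 := Finset.card_erase_of_mem hS0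
  have ht1 : 1 ≤ f.support.card := Finset.card_pos.2 ⟨0, hS0⟩
  unfold newtonVertexCount
  calc (Set.extremePoints ℝ (convexHull ℝ (emb '' ((f * g + 1).support : Set (Fin 2 →₀ ℕ))))).ncard
      = V.ncard := by rw [hV, hP, hT]
    _ ≤ (((J.image fun p => emb (p + p)) ∪ K.image emb : Finset (Fin 2 → ℝ)) : Set (Fin 2 → ℝ)).ncard :=
        Set.ncard_le_ncard hVJK (Finset.finite_toSet _)
    _ = ((J.image fun p => emb (p + p)) ∪ K.image emb).card := Set.ncard_coe_finset _
    _ ≤ (J.image fun p => emb (p + p)).card + (K.image emb).card := Finset.card_union_le _ _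
    _ ≤ J.card + K.card := Nat.add_le_add Finset.card_image_le Finset.card_image_le
    _ = (J ∪ K).card + (J ∩ K).card := (Finset.card_union_add_card_inter J K).symm
    _ ≤ S'.card + 2 := Nat.add_le_add (Finset.card_le_card hJKS) hJK
    _ ≤ f.support.card + 1 := by rw [hcardS']; omega

/-! ### Theorem 7 -/

/-- **KPTT 2015, Appendix, Theorem 7.** Printed: "Under the same assumptions (i) and (ii) as
above, `Newt(fg+1)` has at most `t + 1` edges where `t` denotes the number of monomials of `f` and
`g`." Here: `f`, `g` bivariate over a commutative domain with (i) `Mon(f) = Mon(g)` (of size `t`)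
and (ii) — required only "if `f` and `g` have a constant term", i.e. `0 ∈ Mon(f)` — for every
nonzero `p_j ∈ Mon(f)` whose embedding is an extreme point of `conv(Mon(f) ∖ {0})`, `2p_j ∉ Mon(f)`;
then `Newt(fg + 1)` has at most `t + 1` vertices (`newtonVertexCount`, the tree's count of
vertices = KPTT's count of edges). Proof as printed, by the three cases
`newtonVertexCount_mul_add_one_le_of_coeff_ne` / `_of_coeff_eq` (Proposition 2, Lemma 3). KPTT
note that (ii) cannot be dropped from Proposition 2 (their example after it) and that a linear
bound under (i) alone is open. [cite: KoiranPortierTavenasThomasse2015, Appendix, Thm. 7 (held text p0011:L70–L95)] -/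
theorem newtonVertexCount_mul_add_one_le (f g : MvPolynomial (Fin 2) k) (hfg : f.support = g.support)
    (hii : (0 : Fin 2 →₀ ℕ) ∈ f.support → ∀ p ∈ f.support, p ≠ 0 →
      (fun i : Fin 2 => ((p i : ℕ) : ℝ)) ∈ (convexHull ℝ ((fun e : Fin 2 →₀ ℕ => fun i : Fin 2 => ((e i : ℕ) : ℝ)) ''
        ((f.support.erase 0 : Finset (Fin 2 →₀ ℕ)) : Set (Fin 2 →₀ ℕ)))).extremePoints ℝ →
      2 • p ∉ f.support) :
    newtonVertexCount (f * g + 1) ≤ f.support.card + 1 := by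
  by_cases h0 : (f * g + 1).coeff 0 = 0
  · exact newtonVertexCount_mul_add_one_le_of_coeff_eq f g hfg h0 (hii (zero_mem_support_of_coeff_eq h0))
  · exact newtonVertexCount_mul_add_one_le_of_coeff_ne f g hfg h0

end Polys

end KPTT

end Literature.Computability.AlgebraicComplexity
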